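import Summits.ResolutionOfSingularities.ResolutionOfSingularities.Theorems.EquisingularLiftEquisingularLiftNatNodalEmbeddedCurveLiftDefs
import Summits.ResolutionOfSingularities.ResolutionOfSingularities.Theorems.EquisingularLiftEquisingularLiftNatNodalHostedRoundDefs
import Summits.ResolutionOfSingularities.ResolutionOfSingularities.Theorems.EquisingularLiftEquisingularLiftNatHostedRoundKeep
import Summits.ResolutionOfSingularities.ResolutionOfSingularities.Theorems.EquisingularLiftEquisingularLiftNatCrossedLetterNodal
import HarnessLib

/-!
# [OURS · L1 W4.5(b) · EL♮(3) · WIDTH TABLE D8 «NODAL HOSTED ROUND (HR-KEEP-N)», support debt S-D8-LIFT, part 3] THE NODAL HOSTED ROUND FROM THE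
# NODAL LIFT: `nodalHostedRoundFact_of_nodalEmbeddedCurveLiftFact : NodalEmbeddedCurveLiftFact → NodalHostedRoundFact`

res-L1-w45b-stub-4 g14 (desk R69 (iii): S-D8-LIFT booked as stub-4's support debt; plan of record `L/res-L1-w45b-stub-4/g13/S-D8-LIFT-PLAN.md`,
step (3)).  OURS; NOT a statement of any manuscript ([Hironaka2017] is a candidate under adjudication, nothing of it is asserted); AI-written, weaker
than expert review.  No `sorry`; standard axioms; DEF-FREE; ONE named-fact hypothesis `hF : NodalEmbeddedCurveLiftFact` (the nodal residue (T-k)-N,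
…NatNodalEmbeddedCurveLiftDefs), exactly as ✓ `TCPlus.hround_keep` takes F-88.  `--supports stmt-ResolutionOfSingularities-20148 --as helper`.

WHAT.  `NodalHostedRoundFact` (✓ p693330, res-type-027 — the HROUND-KEEP-N supplier binder of the K5⁸ engine at `n := 3`, RUNG⁸'s one new hypothesis)
REDUCED to the nodal lift residue: `theorem nodalHostedRoundFact_of_nodalEmbeddedCurveLiftFact (hF : NodalEmbeddedCurveLiftFact) : NodalHostedRoundFact`.
With ✓ `embeddedCurveLiftFact_of_nodal : NodalEmbeddedCurveLiftFact → EmbeddedCurveLiftFact` (same Defs file) BOTH lift hypotheses of RUNG⁸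
(`EmbeddedCurveLiftFact → NodalHostedRoundFact → …`) follow from the single named residue `NodalEmbeddedCurveLiftFact`:
`nd_leaves_rung_threeP8_hypotheses_of_nodal` packages the pair.

PROOF (pure composition, no new mathematics) = ✓ `TCPlus.hround_keep`'s body VERBATIM with exactly two swaps, the two places where «`Z̃` regular» was
read: the (T-k) call becomes `hF … hZfin hEreg hunobs hN4` (nodal lift: (N1) finite non-regular locus and (N4) the normal section, instead of
«`Z̃` regular»), and the members' (CL) call becomes ✓ `TCPlus.crossedLetter_clausesN` (…NatCrossedLetterNodal, p694196: the bridge without regularity,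
`G` Jacobson).  Host letter by ★ HT2′ `TCPlus.letterDatum_transport_hostedRound'`, frames by ✓ `hFrame_of_ringKrullDim_redSub` (`n = 3`), model square
by ✓ `modelStep_chain`, birth by ✓ (EB₀) `TCPlus.excLetter_birth₀` — all unchanged, none of them reads regularity of `Z̃`.
[folklore; pure composition of ✓ p682536's ingredients, ✓ (CL)-N, ✓ (EB₀)]
-/

set_option linter.dupNamespace false -- mandated namespace `Summit.<Summit>.<Problem>` of this single-conjunct summit
set_option linter.overlappingInstances false -- signatures carry `[IsDomain O] [IsDiscreteValuationRing O]`

noncomputable section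

open CategoryTheory CategoryTheory.Limits AlgebraicGeometry TopologicalSpace Topology IsLocalRing
open Literature.AlgebraicGeometry.Resolution
open AlgebraicGeometry.Scheme.IdealSheafData
open Summit.ResolutionOfSingularities.ResolutionOfSingularities.Theses.EquisingularLift.Split
open Summit.ResolutionOfSingularities.ResolutionOfSingularities.Cruxes.EquisingularLift.StrataSplit

namespace Summit.ResolutionOfSingularities.ResolutionOfSingularities.Cruxes.EquisingularLiftNat.Sections

/-- ★ **S-D8-LIFT REDUCED TO THE NODAL LIFT: `NodalEmbeddedCurveLiftFact → NodalHostedRoundFact`.**  The HROUND-KEEP-N supplier of the K5⁸ engine at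
`n = 3` (✓ p693330's named `Prop`, unfolded as the first step) from the nodal residue (T-k)-N, by ✓ `TCPlus.hround_keep`'s composition with the (T-k)
call fed (N1)/(N4) and the members served by ✓ (CL)-N `TCPlus.crossedLetter_clausesN`.  See the module docstring. [folklore; pure composition]
[OURS · L1 W4.5b · WIDTH TABLE D8, support debt S-D8-LIFT, reduction] -/
theorem nodalHostedRoundFact_of_nodalEmbeddedCurveLiftFact (hF : NodalEmbeddedCurveLiftFact) : NodalHostedRoundFact := by
  intro k _ _ O _ _ _ _ _ θ hθ P q Y Ch hChStep hChSplit hYsp hYirr hYcl hPint hPnoeth hPreg hqprop hqsm X' σ' S' hCh' hX'int hX'noeth hX'reg hX'dom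
    F₁ hF₁ j t hsq T₁ hT₁cl hT₁irr hjT₁ Ls hLs E₁ Z hZ F₃ υ' hE₁ hZE hZT hTZ hZfin hEreg hunobs hN4 hZdim hOthers hυ'
  classical
  haveI := hPint; haveI := hPnoeth; haveI := hX'int; haveI := hX'noeth; haveI := hF₁; haveI := hqprop; haveI := hqsm
  obtain ⟨𝓔, hEtr, hEpr, hEreg', hEoff, hEfl⟩ := hLs E₁ hE₁
  -- properness of the stage over `O` (for (T-k)-N's properness input)
  have hch : Chain P Y X' σ' S' := hChSplit _ _ _ hCh'
  obtain ⟨-, -, hσ'prop⟩ := chain_isRegular P Y X' σ' S' hch hPnoeth hPreg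
  haveI := hσ'prop
  have hEprop : IsProper (𝓔.subschemeι ≫ σ' ≫ q) := inferInstance
  -- the host's model is not `⊥`: (l-iv) and the fibre of the chain over the generic point of `Y`
  have h𝓔0 : 𝓔 ≠ ⊥ := by
    obtain ⟨ξ, hξ⟩ : ∃ ξ : P, IsGenericPoint ξ Y := QuasiSober.sober hYirr hYcl
    obtain ⟨ξ', hfib', -⟩ := Chain.fibre hch hξ
    intro h0
    have hmem : ξ' ∈ (𝓔.support : Set X') := by rw [h0, Scheme.IdealSheafData.support_bot]; trivial
    have hgen : σ' ξ' = ξ := by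
      have : ξ' ∈ σ' ⁻¹' {ξ} := by rw [hfib']; exact Set.mem_singleton ξ'
      exact this
    exact hEoff ⟨ξ', hmem, rfl⟩ (hgen ▸ hξ)
  -- (T-k)-N AT THE HOST'S MODEL: the centre `C ⊇ 𝓔`, kept in hand — fed (N1) `hZfin` and (N4) `hN4` instead of «`Z̃` regular»
  obtain ⟨C, hEC, hCreg, hCfl, hCj, -⟩ := hF k O θ hθ P q X' σ' 𝓔 hX'int hX'noeth hX'reg hEreg' hEfl hEprop F₁ j t hsq (closure E₁)
    isClosed_closure hEtr Z hZ hZE hZfin hEreg hunobs hN4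
  have hC0 : C ≠ ⊥ := fun h => h𝓔0 (le_bot_iff.mp (h ▸ hEC))
  -- E1-legality of `C` upstairs: off the generic point of `Y`
  have hoff : σ' '' (C.support : Set X') ⊆ {y : P | ¬ IsGenericPoint y Y} :=
    image_support_subset_not_isGenericPoint_of_chain θ hθ q Y hYsp σ' S' hch j t hsq T₁ hjT₁ C Z hZ hCj hTZ
  -- the blow-up of `C`, its `Ch`-stage and the model square for `υ'`
  have hDT : (((vanishingIdeal (⟨Z, hZ⟩ : Closeds F₁)) : F₁.IdealSheafData).support : Set F₁) ⊆ T₁ := by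
    rw [Scheme.IdealSheafData.coe_support_vanishingIdeal]; exact hZT
  have hTD : ¬ T₁ ⊆ (((vanishingIdeal (⟨Z, hZ⟩ : Closeds F₁)) : F₁.IdealSheafData).support : Set F₁) := by
    rw [Scheme.IdealSheafData.coe_support_vanishingIdeal]; exact hTZ
  obtain ⟨X₃, τ₃, hτ₃⟩ := exists_isBlowup X' C
  obtain ⟨hX₃i, hX₃n, hX₃r, hX₃dom, hF₃i, hirr₃, j₃, t₃, hsq₃, hcomm₃, hCh₃⟩ :=
    modelStep_chain O k θ hθ P q Y hYirr hYcl Ch hChSplit hChStep X' σ' S' hCh' hX'reg hX'dom F₁ j t hsq T₁ hjT₁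
      C (vanishingIdeal (⟨Z, hZ⟩ : Closeds F₁)) hCj hCreg hCfl hoff hDT hTD X₃ τ₃ hτ₃ F₃ υ' hυ'
  rw [Scheme.IdealSheafData.coe_support_vanishingIdeal] at hirr₃ hCh₃
  haveI := hX₃n; haveI := hX₃i; haveI := hF₃i
  haveI : IsClosedImmersion (Spec.map (CommRingCat.ofHom θ)) := IsClosedImmersion.spec_of_surjective _ hθ
  haveI hjci : IsClosedImmersion j := MorphismProperty.IsStableUnderBaseChange.of_isPullback hsq.flip inferInstance
  haveI : IsLocallyNoetherian F₁ := LocallyOfFiniteType.isLocallyNoetherian j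
  haveI hj₃ci : IsClosedImmersion j₃ := MorphismProperty.IsStableUnderBaseChange.of_isPullback hsq₃.flip inferInstance
  haveI : IsLocallyNoetherian F₃ := LocallyOfFiniteType.isLocallyNoetherian j₃
  -- the 2-frames of `C` (the curve clause and `n = 3`)
  have hfr : ∀ x ∈ C.support, ∃ c : Fin 2 → X'.presheaf.stalk x, Ideal.span (Set.range c) = stalkIdeal C x ∧ IsQuasiRegular c :=
    hFrame_of_ringKrullDim_redSub O k θ hθ P q Y hYirr hYcl hPnoeth hPreg Ch hChSplit T₁ Z hZ hZdim X' σ' S' j t C hCh' hX'int hX'noeth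
      hX'reg hX'dom hsq hjT₁ hCj hCfl hCreg
  -- the host letter of the strict transform (HT2′)
  have hL₉ : TCPlus.LetterDatum O P q Y F₃ X₃ (τ₃ ≫ σ') j₃ (closure (υ' ⁻¹' (closure E₁ \ Z))) :=
    TCPlus.letterDatum_transport_hostedRound' O k θ hθ q Y σ' hX'reg j t hsq isClosed_closure 𝓔 hEtr hEpr hEreg' hEoff hEfl h𝓔0 C hEC hZ
      hCj hCfl hCreg hfr hτ₃ hυ' j₃ t₃ hsq₃ hcomm₃
  -- EVERY listed letter after the round: the host by HT2′, the others by (CL)-N (no regularity of `Z̃`)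
  have hLs₃ : ∀ L ∈ Ls, TCPlus.LetterDatum O P q Y F₃ X₃ (τ₃ ≫ σ') j₃ (closure (υ' ⁻¹' (closure L \ Z))) := by
    intro L hL
    by_cases hLe : L = E₁
    · subst hLe; exact hL₉
    · obtain ⟨hc1, hc2⟩ := hOthers L hL hLe
      obtain ⟨𝓛, hl1, hl2, hl3, hl4, hl5⟩ := hLs L hL
      obtain ⟨h1, h2, h3, h4, h5⟩ := TCPlus.crossedLetter_clausesN k O θ hθ q Y σ' hX'reg hX₃r j t hsq C hZ hCj hCfl hCreg hC0 hZdim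
        hτ₃ hυ' j₃ t₃ hsq₃ hcomm₃ L 𝓛 hl1 hl2 hl3 hl4 hl5 hc1 hc2
      refine ⟨strictTransformIdeal τ₃ C 𝓛, ?_, h2, h3, h4, h5⟩
      rw [h1]
      congr 1
      exact Closeds.ext closure_closure.symm
  -- THE BIRTH of the exceptional letter (EB₀)
  have hE₃ : TCPlus.LetterDatum O P q Y F₃ X₃ (τ₃ ≫ σ') j₃ (υ' ⁻¹' Z) :=
    TCPlus.excLetter_birth₀ k O θ hθ q Y σ' hX'reg j t hsq C Z hZ hCj hCfl hCreg hfr hoff hτ₃ j₃ t₃ hsq₃ hcomm₃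
  exact ⟨X₃, τ₃ ≫ σ', _, j₃, t₃, hCh₃, hX₃i, hX₃n, hX₃r, hX₃dom, hsq₃, rfl, isClosed_closure, hirr₃, hF₃i, hLs₃, hE₃⟩

/-- **Both lift hypotheses of RUNG⁸ from the single nodal residue**: `NodalEmbeddedCurveLiftFact` yields the pair
`EmbeddedCurveLiftFact ∧ NodalHostedRoundFact` that ✓/⊙ `nd_leaves_rung_threeP8` consumes (`EmbeddedCurveLiftFact → NodalHostedRoundFact → …`).
[OURS · pure logic] -/
theorem nd_leaves_rung_threeP8_hypotheses_of_nodal (hF : NodalEmbeddedCurveLiftFact) : EmbeddedCurveLiftFact ∧ NodalHostedRoundFact :=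
  ⟨embeddedCurveLiftFact_of_nodal hF, nodalHostedRoundFact_of_nodalEmbeddedCurveLiftFact hF⟩

end Summit.ResolutionOfSingularities.ResolutionOfSingularities.Cruxes.EquisingularLiftNat.Sections

end
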